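import Summits.Ventures.GridStability.Models.NE39SPLurie
import Summits.Ventures.GridStability.Models.StructurePreservingSlabWindow
import Summits.Ventures.GridStability.Models.StructurePreservingSlabRankOne

/-!
# GridStability/Models/NE39SPSlab — the SLAB (S-procedure + POPOV) receptacle of «G2.b-SP NE39»: lit-6's
# Lur'e–Postnikov certificate on `NE39SP.relLurie D`, every certificate-independent hypothesis discharged
# (instance typing; NO certificate here)

LADDER-GRIDFUSION G2 «SP–Lur'e lane» / G3 register, seat gridfusion-model-2 (g6); lead R-G2-WAVE1 (a)
(2026-08-27T05:00:34Z): the Popov-free receptacle `NE39SP.lurie_roa_of_eps` (NE39SPLurie.lean) is kept as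
a floor, this file is the receptacle a producer can fill at printed-class damping (sos-4 04:59:07Z (3):
Popov tier passes where sector-only LMIs fail). Data = the tree's `NE39SP` literals (sp49.json fddec35dcf838149 column LF);
reference bus 39. Generated by `gen_slab_append.py` (model-2 g6 session folder; staged HOME/lean/model-2/).
THREE COLUMNS: CERTIFIED (given `Λ`) = the two statements below about MODEL M′ =
`(NE39SP.params D).phaseField`; MODELLED = the `NE39SP` tokens + D⟨declared⟩ + slab u⟨declared⟩;
VALIDATED = any float. Nothing here says the system is stable.
-/

noncomputable section

open Finset Real Set Filter Matrix
open scoped Topology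
open Literature.MathematicalPhysics.PowerSystems
open Literature.MathematicalPhysics.PowerSystems.LyapunovFunctionFamily

namespace Summit.Ventures.GridStability.Models.NE39SP

open StructurePreserving StructurePreserving.Params

/-! ## The SLAB (S-procedure + POPOV) receptacle (model-2 g6; lead R-G2-WAVE1 (a) 2026-08-27T05:00:34Z)

sos-4 measures the Popov-free shape (`QuadraticCertificate`, receptacle `lurie_roa_of_eps` above)
infeasible at printed-class damping while the Popov tier passes; lit-6's `SlabCertificate` (p497347)
ON `relLurie D` is therefore the producer target. Below: every hypothesis of
`Params.tendsto_relState_of_slabCertificate_of_window` (p500128) discharged for this instance except the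
producer's: `Λ : SlabCertificate (relLurie D)` (two PSD facts: `P − ε·1`, 58 × 58; `−slabMatrix`,
114 × 114), the declared slab `u ∈ ℚ` (`0 < u ≤ 1`, half-width `γ = 2·arctan u`), a rational `γ_lo`
with `γ_lo²(1 + u²) ≤ 4u²`, and the comparisons `Λ.a e ≤ slabSlope u`, `1 ≤ Λ.b e`, `2c ≤ ε·γ_lo²`. -/

/-- **Exact lower sector slope for a declared slab** `γ = 2·arctan u`:
`slabSlope u = cos(θ + γ) = ((1 − τ²)(1 − u²) − 4τu)/((1 + τ²)(1 + u²))`, `τ = τ_max`. A channel with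
a Popov coefficient needs `Λ.a e ≥ 0`, i.e. in practice `slabSlope u ≥ 0` (`θ + γ ≤ π/2`). -/
def slabSlope (u : ℚ) : ℚ :=
  ((1 - tauLF ^ 2) * (1 - u ^ 2) - 4 * tauLF * u) / ((1 + tauLF ^ 2) * (1 + u ^ 2))

/-- **SLAB (S-procedure + Popov) sentence for «G2.b-SP NE39» with the ε-level — the producer supplies ONLY
`Λ : SlabCertificate (relLurie D)`, `u`, `γ_lo` and rational comparisons.** For every DECLARED
`D > 0`, every exact slab certificate `Λ` [cite: Pai1981, §2.16 Theorem [18] eqs. (2.63)–(2.64)] on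
`relLurie D` with sector slopes `Λ.a e ≤ slabSlope u`, `1 ≤ Λ.b e` on all 56 lines, and a level
`2c ≤ ε·γ_lo²`: from every phase point `y = (δ, ω)` whose listed line-angle deviations satisfy
`|σ_e − σ*_e| ≤ γ_lo` and with `V(relState y) ≤ c` (`V = xᵀPx + 2Σ λ_e ∫F_e`), a solution of MODEL
M′ = `(params D).phaseField` exists (unique by `phaseSolution_unique`) and EVERY solution keeps
`|σ_e(t) − σ*_e| < 2·arctan u` and `V ≤ c` for all `t ≥ 0`, every bus-angle difference tends to the
equilibrium's and every machine frequency deviation tends to `0`. NO observability hypothesis (decay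
rate `η > 0`). CERTIFIED given `Λ`; MODELLED: instance tokens of `NE39SP` + D⟨declared⟩ + ref bus 39; inner estimate; nothing here says the system is
stable. [cite: Pai1981, §2.16 Theorem [18] and §4.6–§4.7; VuTuritsyn2017, §4.3 Theorem 1] -/
theorem slab_roa_of_eps {D : Fin 49 → ℝ} (hD : ∀ i, 0 < D i) (Λ : SlabCertificate (relLurie D))
    {u γlo : ℚ} (hu0 : 0 < u) (hu1 : u ≤ 1) (hγ0 : 0 ≤ γlo) (hγ : γlo ^ 2 * (1 + u ^ 2) ≤ 4 * u ^ 2)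
    (ha : ∀ e, Λ.a e ≤ (slabSlope u : ℝ)) (hb1 : ∀ e, 1 ≤ Λ.b e)
    {c : ℝ} (hc : 2 * c ≤ Λ.ε * (γlo : ℝ) ^ 2)
    {y : (Fin 49 → ℝ) × (Fin 49 → ℝ)}
    (hy : ∀ e, |(y.1 (srcV e) - y.1 (tgtV e)) - (δ₀ (srcV e) - δ₀ (tgtV e))| ≤ (γlo : ℝ))
    (hyc : Λ.V (relState ref gnode δ₀ y) ≤ c) :
    (∃ X : ℝ → (Fin 49 → ℝ) × (Fin 49 → ℝ), X 0 = y ∧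
        ∀ T : ℝ, ∀ t ∈ Icc 0 T, HasDerivWithinAt X ((params D).phaseField (X t)) (Icc 0 T) t) ∧
      ∀ X : ℝ → (Fin 49 → ℝ) × (Fin 49 → ℝ), X 0 = y →
        (∀ T : ℝ, ∀ t ∈ Icc 0 T, HasDerivWithinAt X ((params D).phaseField (X t)) (Icc 0 T) t) →
        (∀ t, 0 ≤ t →
            (∀ e, |((X t).1 (srcV e) - (X t).1 (tgtV e)) - (δ₀ (srcV e) - δ₀ (tgtV e))|
              < 2 * Real.arctan u) ∧
            Λ.V (relState ref gnode δ₀ (X t)) ≤ c) ∧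
          (∀ v w, Tendsto (fun t => (X t).1 v - (X t).1 w) atTop (𝓝 (δ₀ v - δ₀ w))) ∧
          ∀ v ∈ genS, Tendsto (fun t => (X t).2 v) atTop (𝓝 0) := by
  refine ⟨(params D).exists_phaseSolution_Icc y, fun X hX0 hX => ?_⟩
  subst hX0
  have hτ1 : ((tauLF : ℚ) : ℝ) < 1 := by exact_mod_cast (show tauLF < 1 by norm_num [tauLF])
  have hu0' : (0 : ℝ) < (u : ℝ) := by exact_mod_cast hu0
  have hu1' : (u : ℝ) ≤ 1 := by exact_mod_cast hu1
  have hγ0' : (0 : ℝ) ≤ (γlo : ℝ) := by exact_mod_cast hγ0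
  have hγ' : (γlo : ℝ) ^ 2 * (1 + (u : ℝ) ^ 2) ≤ 4 * (u : ℝ) ^ 2 := by exact_mod_cast hγ
  have ha' : ∀ e, Λ.a e ≤ ((1 - ((tauLF : ℚ) : ℝ) ^ 2) * (1 - (u : ℝ) ^ 2) - 4 * ((tauLF : ℚ) : ℝ) * u)
      / ((1 + ((tauLF : ℚ) : ℝ) ^ 2) * (1 + (u : ℝ) ^ 2)) := fun e => by
    have hsc : ((slabSlope u : ℚ) : ℝ) = ((1 - ((tauLF : ℚ) : ℝ) ^ 2) * (1 - (u : ℝ) ^ 2)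
        - 4 * ((tauLF : ℚ) : ℝ) * u) / ((1 + ((tauLF : ℚ) : ℝ) ^ 2) * (1 + (u : ℝ) ^ 2)) := by
      push_cast [slabSlope]
      ring
    rw [← hsc]; exact ha e
  obtain ⟨hstay, hlim⟩ := tendsto_relState_of_slabCertificate_of_window (wellFormed hD)
    ref_not_mem gnode_injective mem_genS_iff (params_b_eq D) (pe_δ₀_eq_P0 D) Λ hτ1
    lineAngle_abs_le_theta hu0' hu1' hγ0' hγ' ha' hb1 hc hX hy hyc
  exact ⟨hstay, tendsto_of_tendsto_relState (p := params D) mem_genS_iff hlim⟩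

/-- **The slab sentence in the PRINTED second-order vocabulary** (`(params D).IsSolution δ`; `ω₀ = 0`
since `P⁰ := f(δ₀)`): deviations stay `< 2·arctan u`, angle differences converge to the equilibrium's,
machine speeds `δ̇ᵥ → 0`. MODELLED as `slab_roa_of_eps`.
[cite: Pai1981, §2.16 Theorem [18] and §4.7; VuTuritsyn2017, §4.3 Theorem 1; Padiyar2013, §3.2 eq (3.2)] -/
theorem slab_roa_of_eps_of_isSolution {D : Fin 49 → ℝ} (hD : ∀ i, 0 < D i)
    (Λ : SlabCertificate (relLurie D))
    {u γlo : ℚ} (hu0 : 0 < u) (hu1 : u ≤ 1) (hγ0 : 0 ≤ γlo) (hγ : γlo ^ 2 * (1 + u ^ 2) ≤ 4 * u ^ 2)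
    (ha : ∀ e, Λ.a e ≤ (slabSlope u : ℝ)) (hb1 : ∀ e, 1 ≤ Λ.b e)
    {c : ℝ} (hc : 2 * c ≤ Λ.ε * (γlo : ℝ) ^ 2)
    {δ : ℝ → Fin 49 → ℝ} (hδ : (params D).IsSolution δ)
    (h0 : ∀ e, |(δ 0 (srcV e) - δ 0 (tgtV e)) - (δ₀ (srcV e) - δ₀ (tgtV e))| ≤ (γlo : ℝ))
    (hVc : Λ.V (relState ref gnode δ₀ (δ 0, fun v => deriv (fun s => δ s v) 0)) ≤ c) :
    (∀ t, 0 ≤ t → ∀ e, |(δ t (srcV e) - δ t (tgtV e)) - (δ₀ (srcV e) - δ₀ (tgtV e))|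
        < 2 * Real.arctan u) ∧
      (∀ v w, Tendsto (fun t => δ t v - δ t w) atTop (𝓝 (δ₀ v - δ₀ w))) ∧
      ∀ v ∈ genS, Tendsto (fun t => deriv (fun s => δ s v) t) atTop (𝓝 0) := by
  have hsf : (params D).syncFreq = 0 := syncFreq_eq_zero D
  have hτ1 : ((tauLF : ℚ) : ℝ) < 1 := by exact_mod_cast (show tauLF < 1 by norm_num [tauLF])
  have hu0' : (0 : ℝ) < (u : ℝ) := by exact_mod_cast hu0
  have hu1' : (u : ℝ) ≤ 1 := by exact_mod_cast hu1
  have hγ0' : (0 : ℝ) ≤ (γlo : ℝ) := by exact_mod_cast hγ0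
  have hγ' : (γlo : ℝ) ^ 2 * (1 + (u : ℝ) ^ 2) ≤ 4 * (u : ℝ) ^ 2 := by exact_mod_cast hγ
  have ha' : ∀ e, Λ.a e ≤ ((1 - ((tauLF : ℚ) : ℝ) ^ 2) * (1 - (u : ℝ) ^ 2) - 4 * ((tauLF : ℚ) : ℝ) * u)
      / ((1 + ((tauLF : ℚ) : ℝ) ^ 2) * (1 + (u : ℝ) ^ 2)) := fun e => by
    have hsc : ((slabSlope u : ℚ) : ℝ) = ((1 - ((tauLF : ℚ) : ℝ) ^ 2) * (1 - (u : ℝ) ^ 2)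
        - 4 * ((tauLF : ℚ) : ℝ) * u) / ((1 + ((tauLF : ℚ) : ℝ) ^ 2) * (1 + (u : ℝ) ^ 2)) := by
      push_cast [slabSlope]
      ring
    rw [← hsc]; exact ha e
  have hVc' : Λ.V (relState ref gnode δ₀
      (δ 0, fun v => deriv (fun s => δ s v) 0 - (params D).syncFreq)) ≤ c := by
    simpa only [hsf, sub_zero] using hVc
  have h := tendsto_of_isSolution_of_slabCertificate_of_window (p := params D) (wellFormed hD)
    ref_not_mem gnode_injective mem_genS_iff (params_b_eq D) (isSyncEquilibrium D) Λ hτ1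
    lineAngle_abs_le_theta hu0' hu1' hγ0' hγ' ha' hb1 hc hδ h0 hVc'
  rw [hsf] at h
  exact h


/-! ## The SLAB receptacle with the RANK-ONE level (model-2 g6; lead R-SP9-LEVEL 2026-08-27T06:00:29Z)

sos-2's B census on the SP9 canary class: at the SAME certificate the rank-one level (per-line
`s_e·P − C_eᵀC_e ⪰ 0`) certifies ×149 the ε-level (×12 in radius) for `m` extra small PSD facts; this
is the receptacle every later slab row uses (generic theorem
`Params.tendsto_relState_of_slabCertificate_of_rankOne_window`, p505449). -/

/-- **SLAB (S-procedure + Popov) sentence for «G2.b-SP NE39» with the RANK-ONE level.** As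
`slab_roa_of_eps`, but the producer also supplies per-line rationals `s_e > 0` with the 56 PSD facts
`s_e·P − C_eᵀC_e ⪰ 0` (58 × 58 each) and a level `c` with the closed test `c·s_e ≤ γ_lo²` on every
listed line; conclusions identical (slab `|σ_e(t) − σ*_e| < 2·atan u` and `V ≤ c` kept, every bus-angle
difference → the equilibrium's, every machine frequency deviation → 0). CERTIFIED given `Λ` and the
`s_e` facts; MODELLED: instance tokens of `NE39SP` + D⟨declared⟩ + ref bus 39; inner estimate (larger than the ε-level's at the same `Λ`); nothing here says
the system is stable. [cite: Pai1981, §2.16 Theorem [18] and §4.6–§4.7; VuTuritsyn2017, §4.3 Theorem 1 with eq. (V_min)] -/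
theorem slab_roa_of_rankOne {D : Fin 49 → ℝ} (hD : ∀ i, 0 < D i) (Λ : SlabCertificate (relLurie D))
    {u γlo : ℚ} (hu0 : 0 < u) (hu1 : u ≤ 1) (hγ0 : 0 ≤ γlo) (hγ : γlo ^ 2 * (1 + u ^ 2) ≤ 4 * u ^ 2)
    (ha : ∀ e, Λ.a e ≤ (slabSlope u : ℝ)) (hb1 : ∀ e, 1 ≤ Λ.b e)
    {s : Fin 56 → ℝ} (hs0 : ∀ e, 0 < s e)
    (hs : ∀ e, (s e • Λ.P - Matrix.vecMulVec ((relLurie D).C e) ((relLurie D).C e)).PosSemidef)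
    {c : ℝ} (hc : ∀ e, c * s e ≤ (γlo : ℝ) ^ 2)
    {y : (Fin 49 → ℝ) × (Fin 49 → ℝ)}
    (hy : ∀ e, |(y.1 (srcV e) - y.1 (tgtV e)) - (δ₀ (srcV e) - δ₀ (tgtV e))| ≤ (γlo : ℝ))
    (hyc : Λ.V (relState ref gnode δ₀ y) ≤ c) :
    (∃ X : ℝ → (Fin 49 → ℝ) × (Fin 49 → ℝ), X 0 = y ∧
        ∀ T : ℝ, ∀ t ∈ Icc 0 T, HasDerivWithinAt X ((params D).phaseField (X t)) (Icc 0 T) t) ∧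
      ∀ X : ℝ → (Fin 49 → ℝ) × (Fin 49 → ℝ), X 0 = y →
        (∀ T : ℝ, ∀ t ∈ Icc 0 T, HasDerivWithinAt X ((params D).phaseField (X t)) (Icc 0 T) t) →
        (∀ t, 0 ≤ t →
            (∀ e, |((X t).1 (srcV e) - (X t).1 (tgtV e)) - (δ₀ (srcV e) - δ₀ (tgtV e))|
              < 2 * Real.arctan u) ∧
            Λ.V (relState ref gnode δ₀ (X t)) ≤ c) ∧
          (∀ v w, Tendsto (fun t => (X t).1 v - (X t).1 w) atTop (𝓝 (δ₀ v - δ₀ w))) ∧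
          ∀ v ∈ genS, Tendsto (fun t => (X t).2 v) atTop (𝓝 0) := by
  refine ⟨(params D).exists_phaseSolution_Icc y, fun X hX0 hX => ?_⟩
  subst hX0
  have hτ1 : ((tauLF : ℚ) : ℝ) < 1 := by exact_mod_cast (show tauLF < 1 by norm_num [tauLF])
  have hu0' : (0 : ℝ) < (u : ℝ) := by exact_mod_cast hu0
  have hu1' : (u : ℝ) ≤ 1 := by exact_mod_cast hu1
  have hγ0' : (0 : ℝ) ≤ (γlo : ℝ) := by exact_mod_cast hγ0
  have hγ' : (γlo : ℝ) ^ 2 * (1 + (u : ℝ) ^ 2) ≤ 4 * (u : ℝ) ^ 2 := by exact_mod_cast hγ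
  have ha' : ∀ e, Λ.a e ≤ ((1 - ((tauLF : ℚ) : ℝ) ^ 2) * (1 - (u : ℝ) ^ 2) - 4 * ((tauLF : ℚ) : ℝ) * u)
      / ((1 + ((tauLF : ℚ) : ℝ) ^ 2) * (1 + (u : ℝ) ^ 2)) := fun e => by
    have hsc : ((slabSlope u : ℚ) : ℝ) = ((1 - ((tauLF : ℚ) : ℝ) ^ 2) * (1 - (u : ℝ) ^ 2)
        - 4 * ((tauLF : ℚ) : ℝ) * u) / ((1 + ((tauLF : ℚ) : ℝ) ^ 2) * (1 + (u : ℝ) ^ 2)) := by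
      push_cast [slabSlope]
      ring
    rw [← hsc]; exact ha e
  obtain ⟨hstay, hlim⟩ := tendsto_relState_of_slabCertificate_of_rankOne_window (wellFormed hD)
    ref_not_mem gnode_injective mem_genS_iff (params_b_eq D) (pe_δ₀_eq_P0 D) Λ hτ1
    lineAngle_abs_le_theta hu0' hu1' hγ0' hγ' ha' hb1 hs0 hs hc hX hy hyc
  exact ⟨hstay, tendsto_of_tendsto_relState (p := params D) mem_genS_iff hlim⟩

/-- **The rank-one-level slab sentence in the PRINTED second-order vocabulary** (`(params D).IsSolution δ`;
`ω₀ = 0`). MODELLED as `slab_roa_of_rankOne`.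
[cite: Pai1981, §2.16 Theorem [18] and §4.7; VuTuritsyn2017, §4.3 Theorem 1; Padiyar2013, §3.2 eq (3.2)] -/
theorem slab_roa_of_rankOne_of_isSolution {D : Fin 49 → ℝ} (hD : ∀ i, 0 < D i)
    (Λ : SlabCertificate (relLurie D))
    {u γlo : ℚ} (hu0 : 0 < u) (hu1 : u ≤ 1) (hγ0 : 0 ≤ γlo) (hγ : γlo ^ 2 * (1 + u ^ 2) ≤ 4 * u ^ 2)
    (ha : ∀ e, Λ.a e ≤ (slabSlope u : ℝ)) (hb1 : ∀ e, 1 ≤ Λ.b e)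
    {s : Fin 56 → ℝ} (hs0 : ∀ e, 0 < s e)
    (hs : ∀ e, (s e • Λ.P - Matrix.vecMulVec ((relLurie D).C e) ((relLurie D).C e)).PosSemidef)
    {c : ℝ} (hc : ∀ e, c * s e ≤ (γlo : ℝ) ^ 2)
    {δ : ℝ → Fin 49 → ℝ} (hδ : (params D).IsSolution δ)
    (h0 : ∀ e, |(δ 0 (srcV e) - δ 0 (tgtV e)) - (δ₀ (srcV e) - δ₀ (tgtV e))| ≤ (γlo : ℝ))
    (hVc : Λ.V (relState ref gnode δ₀ (δ 0, fun v => deriv (fun s => δ s v) 0)) ≤ c) :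
    (∀ t, 0 ≤ t → ∀ e, |(δ t (srcV e) - δ t (tgtV e)) - (δ₀ (srcV e) - δ₀ (tgtV e))|
        < 2 * Real.arctan u) ∧
      (∀ v w, Tendsto (fun t => δ t v - δ t w) atTop (𝓝 (δ₀ v - δ₀ w))) ∧
      ∀ v ∈ genS, Tendsto (fun t => deriv (fun s => δ s v) t) atTop (𝓝 0) := by
  have hsf : (params D).syncFreq = 0 := syncFreq_eq_zero D
  have hτ1 : ((tauLF : ℚ) : ℝ) < 1 := by exact_mod_cast (show tauLF < 1 by norm_num [tauLF])
  have hu0' : (0 : ℝ) < (u : ℝ) := by exact_mod_cast hu0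
  have hu1' : (u : ℝ) ≤ 1 := by exact_mod_cast hu1
  have hγ0' : (0 : ℝ) ≤ (γlo : ℝ) := by exact_mod_cast hγ0
  have hγ' : (γlo : ℝ) ^ 2 * (1 + (u : ℝ) ^ 2) ≤ 4 * (u : ℝ) ^ 2 := by exact_mod_cast hγ
  have ha' : ∀ e, Λ.a e ≤ ((1 - ((tauLF : ℚ) : ℝ) ^ 2) * (1 - (u : ℝ) ^ 2) - 4 * ((tauLF : ℚ) : ℝ) * u)
      / ((1 + ((tauLF : ℚ) : ℝ) ^ 2) * (1 + (u : ℝ) ^ 2)) := fun e => by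
    have hsc : ((slabSlope u : ℚ) : ℝ) = ((1 - ((tauLF : ℚ) : ℝ) ^ 2) * (1 - (u : ℝ) ^ 2)
        - 4 * ((tauLF : ℚ) : ℝ) * u) / ((1 + ((tauLF : ℚ) : ℝ) ^ 2) * (1 + (u : ℝ) ^ 2)) := by
      push_cast [slabSlope]
      ring
    rw [← hsc]; exact ha e
  have hVc' : Λ.V (relState ref gnode δ₀
      (δ 0, fun v => deriv (fun s => δ s v) 0 - (params D).syncFreq)) ≤ c := by
    simpa only [hsf, sub_zero] using hVc
  have h := tendsto_of_isSolution_of_slabCertificate_of_rankOne_window (p := params D) (wellFormed hD)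
    ref_not_mem gnode_injective mem_genS_iff (params_b_eq D) (isSyncEquilibrium D) Λ hτ1
    lineAngle_abs_le_theta hu0' hu1' hγ0' hγ' ha' hb1 hs0 hs hc hδ h0 hVc'
  rw [hsf] at h
  exact h

end Summit.Ventures.GridStability.Models.NE39SP

end
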